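import Summits.BirchSwinnertonDyer.Rank1Residual.Additive.GordRankOneKatoUpperBound
import Summits.BirchSwinnertonDyer.Rank1Residual.Additive.GordBranchPAdicGrossZagier
import HarnessLib

/-!
# The (G)-cell at analytic rank ONE, defect 2, `p ≡ 1 (mod 4)`: Kato's divisibility MEETS the typed
# branch `p`-adic Gross–Zagier — the UPPER HALF of `BSD(E,p)` from [Kato + branch p-adic GZ], and on the
# unit-certified rows `BranchPAdicGrossZagierAt ⟺ BSD(E,p)` (cell `b2b-bsdres`, sub-cell additive-p2,
# gen 19; sequel of `GordRankOneKatoUpperBound` and of team n1011's `GordBranchPAdicGrossZagier`)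

HONEST FRAMING (cell `b2b-bsdres`, run/shared/lean/b2b/bsd-rank1-residual/, verbatim in every
file): the goal of the cell is to DELETE the COMBINATION-SHAPED residual classes of the
Birch–Swinnerton-Dyer formula for ALL analytic-rank `≤ 1` elliptic curves over `ℚ` — "full BSD
formula for every rank `≤ 1` curve in class `C`" assembled STRICTLY from published theorems — so
that the rank-`≤ 1` remainder becomes exactly the CONSTRUCTION-SHAPED classes, which are TYPED
(missing-input `Prop`s), NOT attempted. This is not "finishing BSD". Sub-cell `additive-p2`
(CLASS-OWNERS row "X3/X4 additive — pot. good ordinary / X3♯(G-ord)"), generation 19: research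
route; no claim beyond the stated classes; X3♯(G-ord)/X4♯(G-ord) stay CONSTRUCTION-SHAPED; labels /
census / located gap UNCHANGED; nothing is booked. Theorems only (no definition, no new named fact;
named facts enter as HYPOTHESES: the semistable half-eigenspace reading of Kato 2004 Thm. 17.4 (3),
Delbourgo 2002 (A)+(B) = A175, Pal 2012 Thm. 3.2, GZK, modularity; the TYPED input is team n1011's
`BranchPAdicGrossZagierAt W p Dh` — `p`-adic Gross–Zagier on the `ω^{(p−1)/2}`-branch of the good
ordinary twist in Delbourgo's normalisation, OPEN at rank one, RESIDUAL-MAP §I O7-ord).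

## What and why

At a GOOD ordinary prime the classical chain is [Kato: `char X ∣ L_p`] ∘ [Schneider / Perrin-Riou:
algebraic leading term] ∘ [Perrin-Riou 1987: `p`-adic Gross–Zagier] ⟹ `ord_p #Ш ≤ ord_p #Ш_an` in
analytic rank one (Stein–Wuthrich, Math. Comp. 82 (2013) §4/Thm. 8.x). On the DEFECT-2 rows of the
additive (G)-cell the first two links are in the tree (gen 12's [C] + the component reading; A175) and
the third is TYPED by team n1011 (seat p01, `GordBranchPAdicGrossZagier.lean`):
`BranchPAdicGrossZagierAt W p Dh` — `ϖ·[T^r]B·log_p(γ)^r = u·q·Reg_p(E,Dh)`, `L^{(r)}(E,1)/r! = q·Ω_E·Reg_∞`.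
This file composes them (even branch, `p ≡ 1 (mod 4)`, as typed there):

* §1 **`ClassX4Gord.missingUpperBoundAt_rankOne_of_katoHalf_of_branchPAdicGrossZagier`**: on
  X4♯(G-ord) ∩ `I₀*` ∩ {`ρ̄` onto}, `p ≡ 1 (mod 4)`, `p ≥ 5`, `E` non-CM, `r_an = 1`, with the WEAK
  certificate (`[T¹](ϖ·B) ≠ 0`): [Kato component reading] + [`BranchPAdicGrossZagierAt W p Dh` for ONE
  (B)-datum `Dh`] ⟹ **`Typed.MissingUpperBoundAt W p` — `ord_p #Ш(E) ≤ ord_p #Ш_an(E)` on EVERY such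
  row** (anomalous or not: the `ℓ`-term only helps). Gen 18 obtained this from the COMPOSITE typed
  input `CycLeadingTermOneAt` (Kato ∘ pGZ); here the Kato factor is DISCHARGED and only the branch
  `p`-adic Gross–Zagier remains typed. Chain: file 4's bound
  `ord Ш + ord Reg_p + ord ∏c + ord ℓ ≤ ord [T¹](ϖB) + 1 + 2 ord #T` + pGZ's
  `ord(ϖ[T¹]B) + 1 = ord q + ord Reg_p` (Schneider from file 4 makes `Reg_p ≠ 0`) ⟹
  `ord Ш + ord ℓ ≤ ord(q·#T²/∏c) = ord #Ш_an`.
* §2 **`ClassX4Gord.bsdp_rankOne_of_katoHalf_of_cert_of_branchPAdicGrossZagier`**: with the UNIT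
  certificate and off the anomalous rows, [Kato] + [pGZ for one (B)-datum] ⟹ **`BSD(E,p)`** (no main
  conjecture: `ord(ϖ[T¹]B) = 0` pins `ord q + ord Reg_p = 1`, which is file 3's criterion).
* §3 **`ClassX4Gord.branchPAdicGrossZagierAt_iff_bsdp_of_katoHalf_of_cert`**: conversely `BSD(E,p)`
  gives `ord(q·Reg_p(Dh)) = 1 = ord(ϖ·[T¹]B·log_p γ)` for every admissible `(V, f, ϖ)`, so the quotient
  is a unit: on the unit-certified non-anomalous rows **`BranchPAdicGrossZagierAt W p Dh ↔ BSDp W p`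
  for every (B)-datum `Dh`** — the typed `p`-adic Gross–Zagier formula at the additive prime and the
  `p`-part of BSD are ONE statement there (both OPEN; the census X4-2 measures exactly this valuation).

What is NOT claimed: `BranchPAdicGrossZagierAt` (OPEN, rank one); the odd branch `p ≡ 3 (mod 4)` and
X3 (the typed input is even-branch / any image, but this file only does X4 at `p ≡ 1 (mod 4)`); the
(M)-rows; anything booked. Labels UNCHANGED.

References: [Kato2004Asterisque] Thm. 17.4 (3); [Delbourgo2002] Thm. (A), (B); [PerrinRiou1987] §1.4;
[SteinWuthrich2013] §4; [Pal2012] Thm. 3.2; [MazurTateTeitelbaum1986Invent] §I.13–I.14;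
[Miller2011LMS] Def. 1.1.
-/

noncomputable section

open scoped Classical MatrixGroups ModularForm NumberField

namespace Summit.BirchSwinnertonDyer.Rank1Residual.Additive

open CongruenceSubgroup WeierstrassCurve NumberField Literature.NumberTheory.EllipticCurves
  Literature.NumberTheory.EllipticCurves.ModularForms
  Literature.NumberTheory.EllipticCurves.Rank1Residual
  Literature.NumberTheory.EllipticCurves.Rank1Residual.Typed
  Literature.NumberTheory.EllipticCurves.Delbourgo2002
  Literature.NumberTheory.GaloisRepresentations Summit.BirchSwinnertonDyer.Rank1Residual.AdditivePotMult
  Summit.BirchSwinnertonDyer.Rank1Residual.X1.MuLambda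
  Summit.BirchSwinnertonDyer.Rank1Residual.X1.RankOneParitySqueeze
  IsDedekindDomain

variable {W : WeierstrassCurve ℚ} [W.IsElliptic] [W.IsGloballyMinimal] {p : ℕ} [hp : Fact p.Prime]

omit [W.IsElliptic] [W.IsGloballyMinimal] hp in
/-- `p ≡ 1 (mod 4)`: `p* = p` and `(p−1)/2` is even. [folklore] -/
theorem pStar_eq_and_even_of_mod_four_eq_one (hp4 : p % 4 = 1) :
    ((-1 : ℚ) ^ (p / 2) * p) = (p : ℚ) ∧ Even (p / 2) := by
  have heven : Even (p / 2) := ⟨p / 4, by omega⟩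
  exact ⟨by rw [heven.neg_one_pow, one_mul], heven⟩

omit [W.IsGloballyMinimal] in
/-- Two rational `q` with `L^{(r)}(E,1)/r! = q·Ω_E·Reg_∞(E)` coincide (`Ω_E·Reg_∞ ≠ 0`). [folklore] -/
theorem ratCoeff_unique {q q' : ℚ}
    (hq : W.leadingLCoeff = (q : ℂ) * (W.realPeriodRat : ℂ) * (W.regulator : ℂ))
    (hq' : W.leadingLCoeff = (q' : ℂ) * (W.realPeriodRat : ℂ) * (W.regulator : ℂ)) : q = q' := by
  have hΩ : (W.realPeriodRat : ℂ) ≠ 0 := by exact_mod_cast W.realPeriodRat_pos_holds.ne'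
  have hR : (W.regulator : ℂ) ≠ 0 := by exact_mod_cast (regulator_pos_holds W).ne'
  have h := hq.symm.trans hq'
  have : (q : ℂ) = (q' : ℂ) := mul_right_cancel₀ hΩ (mul_right_cancel₀ hR h)
  exact_mod_cast this

/-! ### §1 Kato + branch `p`-adic Gross–Zagier ⟹ the UPPER half at rank one -/

/-- **X4♯(G-ord) ∩ `I₀*` ∩ {`ρ̄` onto}, `p ≡ 1 (mod 4)`, `p ≥ 5`, `E` non-CM, `r_an = 1`: the UPPER HALF
`ord_p #Ш(E) ≤ ord_p #Ш_an(E)` from Kato's divisibility and the typed branch `p`-adic Gross–Zagier for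
ONE (B)-datum** (+ the weak certificate `[T¹](ϖ·B) ≠ 0`; GZK, modularity published; A175 supplies
such a `Dh` on the cell). Every row, anomalous or not. [cite: Kato2004Asterisque, Thm. 17.4 (3) (p. 273)]
[cite: Delbourgo2002, Theorem (A), (B) (p. 40)] [cite: SteinWuthrich2013, §4 (good ordinary template)]
[cite: Miller2011LMS, Def. 1.1] -/
theorem ClassX4Gord.missingUpperBoundAt_rankOne_of_katoHalf_of_branchPAdicGrossZagier
    (hK : Wuthrich2014.kato_halfEigenCharIdeal_dvd_cyclotomicPrime_of_surjective)
    (hmodD : nonempty_modularParametrizationData)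
    (hGZK : rank_eq_analyticRank_of_analyticRank_le_one) (hmod : hasEntireLFunction_rat)
    (hX : ClassX4Gord W p) (hp4 : p % 4 = 1) (hp5 : 5 ≤ p)
    (he : semistabilityIndex W p = 2) (hsurj : Surj W p) (hr : W.analyticRank = 1)
    (hne : BranchCoeffOneNeZeroAt W p)
    (hGZ : ∃ Dh : PAdicHeightData W p, LeadingTermClauses W p Dh ∧ BranchPAdicGrossZagierAt W p Dh) :
    MissingUpperBoundAt W p := by
  have hpP : p.Prime := hp.out
  obtain ⟨Dh, hB, hGZDh⟩ := hGZ
  obtain ⟨hps, heven⟩ := pStar_eq_and_even_of_mod_four_eq_one (p := p) hp4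
  -- the twist datum
  obtain ⟨V, iV, iVm, C, hV, hC⟩ := hX.exists_goodOrd_pStar_twist_model W p he
  haveI : NeZero (V.conductorNorm ℤ) := ⟨(V.conductorNorm_pos_holds).ne'⟩
  obtain ⟨Dm⟩ := hmodD V
  obtain ⟨ϖ, -, hϖ, -⟩ := Dm.exists_rat_mul_realPeriodRat_eq_plusPeriod
  have hϖ' : (if Even (p / 2) then (ϖ : ℝ) * V.realPeriodRat = plusPeriod Dm.f
      else (ϖ : ℝ) * V.imaginaryPeriodRat = minusPeriod Dm.f) := by rw [if_pos heven]; exact hϖ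
  have hord : IsOrdinaryAt V p :=
    isOrdinaryAt_of_goodOrd_or_mult_of_model_twist W V (pStar_ne_zero p) ⟨C, hC⟩
      (padicValRat_j_nonneg_of_typeGOrd W p hX.typeGOrd) (Or.inl hV)
  have hne' := hne V C hC hord Dm.f Dm.isNewformOf ϖ hϖ'
  -- file 4: Schneider and the Kato-type bound
  obtain ⟨hS, ℓ, -, -, hle⟩ := hX.schneider_and_padicVal_le_rankOne_of_katoHalf hK hGZK hp5 hsurj hr
    V C hC hV Dm.isNewformOf ϖ hϖ' hne' hB
  rw [if_pos heven] at hle hne'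
  -- branch p-adic Gross–Zagier at rank 1
  obtain ⟨hmw, hfinSha⟩ := hGZK W (by rw [hr])
  have hr1 : W.mordellWeilRank = 1 := by rw [hmw, hr]
  haveI : Finite W.sha := hfinSha
  have hVW : ∃ C : VariableChange ℚ, C • V.quadraticTwist (p : ℚ) = W := ⟨C, by rw [← hps]; exact hC⟩
  obtain ⟨u, q, hLq, hgz⟩ := hGZDh V hp4 hVW hV Dm.isNewformOf ϖ hϖ
  rw [hr1, pow_one] at hgz
  -- valuations
  have hq0 : q ≠ 0 := by
    rintro rfl
    rw [Rat.cast_zero, zero_mul, zero_mul] at hLq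
    exact W.leadingLCoeff_ne_zero_holds (hmod W) hLq
  have hqQ : ((q : ℚ) : ℚ_[p]) ≠ 0 := by exact_mod_cast hq0
  have hReg : padicRegulator Dh ≠ 0 := hS
  have hu0 : ((u : ℤ_[p]) : ℚ_[p]) ≠ 0 := coe_units_ne_zero p u
  obtain ⟨w, hw⟩ := exists_unit_padicLog_cyclotomicGenerator (p := p) (by omega)
  have hpQ : (p : ℚ_[p]) ≠ 0 := by exact_mod_cast hpP.ne_zero
  have hlog0 : padicLog p (cyclotomicGenerator p : ℚ_[p]) ≠ 0 := by
    rw [hw]; exact mul_ne_zero hpQ (coe_units_ne_zero p w)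
  have hlogv : (padicLog p (cyclotomicGenerator p : ℚ_[p])).valuation = 1 := by
    rw [hw, Padic.valuation_mul hpQ (coe_units_ne_zero p w), Padic.valuation_p,
      valuation_coe_units_eq_zero, add_zero]
  have hcoef : PowerSeries.coeff 1 (PowerSeries.C (ϖ : ℚ_[p]) *
      padicLFunctionBranch Dm.f ((unitRoot V p : ℤ_[p]) : ℚ_[p]) (p / 2)) =
      (ϖ : ℚ_[p]) * PowerSeries.coeff 1 (padicLFunctionBranch Dm.f ((unitRoot V p : ℤ_[p]) : ℚ_[p])
        (p / 2)) := PowerSeries.coeff_C_mul _ _ _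
  rw [hcoef] at hle hne'
  have hval := congrArg Padic.valuation hgz
  rw [Padic.valuation_mul hne' hlog0, hlogv, Padic.valuation_mul (mul_ne_zero hu0 hqQ) hReg,
    Padic.valuation_mul hu0 hqQ, valuation_coe_units_eq_zero, zero_add, Padic.valuation_ratCast] at hval
  -- `#Ш_an = q·#T²/∏c`
  have hsha := shaAn_eq_of_leadingLCoeff_eq W hLq
  have hT0 : (W.torsionOrder : ℚ) ≠ 0 := by exact_mod_cast (W.torsionOrder_pos_holds).ne'
  have hP0 : (W.tamagawaProduct : ℚ) ≠ 0 := by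
    exact_mod_cast (W.tamagawaProduct_pos_holds : 0 < W.tamagawaProduct).ne'
  have hvq : padicValRat p (q * (W.torsionOrder : ℚ) ^ 2 / (W.tamagawaProduct : ℚ)) =
      padicValRat p q + 2 * padicValNat p W.torsionOrder - padicValNat p W.tamagawaProduct := by
    rw [padicValRat.div (mul_ne_zero hq0 (pow_ne_zero 2 hT0)) hP0,
      padicValRat.mul hq0 (pow_ne_zero 2 hT0), padicValRat.pow, padicValRat.of_nat,
      padicValRat.of_nat]
    push_cast
    ring
  refine ⟨_, hsha, ?_⟩
  rw [hvq]
  have hℓ : (0 : ℤ) ≤ padicValNat p ℓ := by exact_mod_cast Nat.zero_le _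
  linarith

/-! ### §2 Unit certificate: Kato + branch `p`-adic Gross–Zagier ⟹ `BSD(E,p)` off the anomalous rows -/

/-- **X4♯(G-ord) ∩ `I₀*` ∩ {`ρ̄` onto}, `p ≡ 1 (mod 4)`, `p ≥ 5`, `E` non-CM, `r_an = 1`, non-anomalous,
UNIT certificate: Kato's divisibility and the typed branch `p`-adic Gross–Zagier for ONE (B)-datum
give `BSD(E,p)`** — no main conjecture: `ord(ϖ·[T¹]B) = 0` and pGZ pin `ord q + ord Reg_p(Dh) = 1`,
which is `GordRankOneKatoCertificateBSD`'s criterion. [cite: Kato2004Asterisque, Thm. 17.4 (3) (p. 273)]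
[cite: Delbourgo2002, Theorem (A), (B) (p. 40)] [cite: Miller2011LMS, Def. 1.1] -/
theorem ClassX4Gord.bsdp_rankOne_of_katoHalf_of_cert_of_branchPAdicGrossZagier
    (hK : Wuthrich2014.kato_halfEigenCharIdeal_dvd_cyclotomicPrime_of_surjective)
    (hmodD : nonempty_modularParametrizationData)
    (hGZK : rank_eq_analyticRank_of_analyticRank_le_one) (hmod : hasEntireLFunction_rat)
    (hX : ClassX4Gord W p) (hp4 : p % 4 = 1) (hp5 : 5 ≤ p)
    (he : semistabilityIndex W p = 2) (hsurj : Surj W p) (hr : W.analyticRank = 1)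
    (hna : ReductionNonAnomalous W p) (hcert : BranchUnitCertificateAt W p)
    {Dh : PAdicHeightData W p} (hB : LeadingTermClauses W p Dh) (hGZ : BranchPAdicGrossZagierAt W p Dh) :
    BSDp W p := by
  have hpP : p.Prime := hp.out
  obtain ⟨hps, heven⟩ := pStar_eq_and_even_of_mod_four_eq_one (p := p) hp4
  obtain ⟨V, iV, iVm, C, hV, hC⟩ := hX.exists_goodOrd_pStar_twist_model W p he
  haveI : NeZero (V.conductorNorm ℤ) := ⟨(V.conductorNorm_pos_holds).ne'⟩
  obtain ⟨Dm⟩ := hmodD V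
  obtain ⟨ϖ, -, hϖ, -⟩ := Dm.exists_rat_mul_realPeriodRat_eq_plusPeriod
  have hϖ' : (if Even (p / 2) then (ϖ : ℝ) * V.realPeriodRat = plusPeriod Dm.f
      else (ϖ : ℝ) * V.imaginaryPeriodRat = minusPeriod Dm.f) := by rw [if_pos heven]; exact hϖ
  have hord : IsOrdinaryAt V p :=
    isOrdinaryAt_of_goodOrd_or_mult_of_model_twist W V (pStar_ne_zero p) ⟨C, hC⟩
      (padicValRat_j_nonneg_of_typeGOrd W p hX.typeGOrd) (Or.inl hV)
  obtain ⟨-, h1⟩ := hcert V C hC hord Dm.f Dm.isNewformOf ϖ hϖ'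
  rw [if_pos heven, PowerSeries.coeff_C_mul] at h1
  -- pGZ at rank 1
  obtain ⟨hmw, -⟩ := hGZK W (by rw [hr])
  have hr1 : W.mordellWeilRank = 1 := by rw [hmw, hr]
  have hVW : ∃ C : VariableChange ℚ, C • V.quadraticTwist (p : ℚ) = W := ⟨C, by rw [← hps]; exact hC⟩
  obtain ⟨u, q, hLq, hgz⟩ := hGZ V hp4 hVW hV Dm.isNewformOf ϖ hϖ
  rw [hr1, pow_one] at hgz
  -- Schneider from the (strong ⟹ weak) certificate
  have hS : SchneiderConjecture Dh :=
    (hX.schneider_and_padicVal_identity_rankOne_of_katoHalf_of_cert hK hmodD hGZK hp5 he hsurj hr hcert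
      hB).1
  have hq0 : q ≠ 0 := by
    rintro rfl
    rw [Rat.cast_zero, zero_mul, zero_mul] at hLq
    exact W.leadingLCoeff_ne_zero_holds (hmod W) hLq
  have hqQ : ((q : ℚ) : ℚ_[p]) ≠ 0 := by exact_mod_cast hq0
  have hu0 : ((u : ℤ_[p]) : ℚ_[p]) ≠ 0 := coe_units_ne_zero p u
  have hReg : padicRegulator Dh ≠ 0 := hS
  obtain ⟨w, hw⟩ := exists_unit_padicLog_cyclotomicGenerator (p := p) (by omega)
  have hpQ : (p : ℚ_[p]) ≠ 0 := by exact_mod_cast hpP.ne_zero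
  have hlog0 : padicLog p (cyclotomicGenerator p : ℚ_[p]) ≠ 0 := by
    rw [hw]; exact mul_ne_zero hpQ (coe_units_ne_zero p w)
  have hlogv : (padicLog p (cyclotomicGenerator p : ℚ_[p])).valuation = 1 := by
    rw [hw, Padic.valuation_mul hpQ (coe_units_ne_zero p w), Padic.valuation_p,
      valuation_coe_units_eq_zero, add_zero]
  have hx0 : (ϖ : ℚ_[p]) * PowerSeries.coeff 1
      (padicLFunctionBranch Dm.f ((unitRoot V p : ℤ_[p]) : ℚ_[p]) (p / 2)) ≠ 0 := by
    intro h0; rw [h0, norm_zero] at h1; exact zero_ne_one h1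
  have hxv : ((ϖ : ℚ_[p]) * PowerSeries.coeff 1
      (padicLFunctionBranch Dm.f ((unitRoot V p : ℤ_[p]) : ℚ_[p]) (p / 2))).valuation = 0 := by
    have := Padic.norm_eq_zpow_neg_valuation hx0
    rw [h1] at this
    have h' : ((p : ℝ) ^ (-((ϖ : ℚ_[p]) * PowerSeries.coeff 1
        (padicLFunctionBranch Dm.f ((unitRoot V p : ℤ_[p]) : ℚ_[p]) (p / 2))).valuation)) = 1 :=
      this.symm
    have hp1 : (1 : ℝ) < p := by exact_mod_cast hpP.one_lt
    have := zpow_right_injective₀ (by positivity) hp1.ne' (h'.trans (zpow_zero _).symm)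
    linarith
  have hval := congrArg Padic.valuation hgz
  rw [Padic.valuation_mul hx0 hlog0, hxv, hlogv, Padic.valuation_mul (mul_ne_zero hu0 hqQ) hReg,
    Padic.valuation_mul hu0 hqQ, valuation_coe_units_eq_zero, zero_add, Padic.valuation_ratCast] at hval
  exact (hX.bsdp_iff_padicVal_rankOne_of_katoHalf_of_cert hK hmodD hGZK hmod hp5 he hsurj hr hna hcert
    hB hLq).mpr (by linarith)

/-! ### §3 On the unit-certified rows the typed branch `p`-adic Gross–Zagier IS `BSD(E,p)` -/

/-- **X4♯(G-ord) ∩ `I₀*` ∩ {`ρ̄` onto}, `p ≡ 1 (mod 4)`, `p ≥ 5`, `E` non-CM, `r_an = 1`, non-anomalous,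
UNIT certificate, `Dh` a (B)-datum: `BranchPAdicGrossZagierAt W p Dh ↔ BSDp W p`.** (⟸: `BSD(E,p)`
gives `ord(q·Reg_p(Dh)) = 1 = ord(ϖ·[T¹]B·log_p γ)` for every admissible `(V, f, ϖ)` — the unit
certificate fixes `ord(ϖ[T¹]B) = 0`, `GordRankOneKatoCertificateBSD` fixes `ord q + ord Reg_p = 1` — so
the quotient is a unit of `ℤ_p`.) The typed `p`-adic Gross–Zagier formula at the additive prime
(RESIDUAL-MAP O7-ord, OPEN) and the `p`-part of BSD are ONE statement on these rows.
[cite: Kato2004Asterisque, Thm. 17.4 (3) (p. 273)] [cite: Delbourgo2002, Theorem (A), (B) (p. 40)]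
[cite: PerrinRiou1987, §1.4 (shape)] [cite: Miller2011LMS, Def. 1.1] -/
theorem ClassX4Gord.branchPAdicGrossZagierAt_iff_bsdp_of_katoHalf_of_cert
    (hK : Wuthrich2014.kato_halfEigenCharIdeal_dvd_cyclotomicPrime_of_surjective)
    (hmodD : nonempty_modularParametrizationData)
    (hGZK : rank_eq_analyticRank_of_analyticRank_le_one) (hmod : hasEntireLFunction_rat)
    (hX : ClassX4Gord W p) (hp4 : p % 4 = 1) (hp5 : 5 ≤ p)
    (he : semistabilityIndex W p = 2) (hsurj : Surj W p) (hr : W.analyticRank = 1)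
    (hna : ReductionNonAnomalous W p) (hcert : BranchUnitCertificateAt W p)
    {Dh : PAdicHeightData W p} (hB : LeadingTermClauses W p Dh) :
    BranchPAdicGrossZagierAt W p Dh ↔ BSDp W p := by
  refine ⟨fun hGZ ↦ hX.bsdp_rankOne_of_katoHalf_of_cert_of_branchPAdicGrossZagier hK hmodD hGZK hmod
    hp4 hp5 he hsurj hr hna hcert hB hGZ, fun hbsd ↦ ?_⟩
  have hpP : p.Prime := hp.out
  obtain ⟨-, heven⟩ := pStar_eq_and_even_of_mod_four_eq_one (p := p) hp4
  -- rank one bookkeeping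
  obtain ⟨hmw, hfinSha⟩ := hGZK W (by rw [hr])
  have hr1 : W.mordellWeilRank = 1 := by rw [hmw, hr]
  haveI : Finite W.sha := hfinSha
  -- `q` with `L'(E,1) = q Ω Reg_∞` (from `#Ш_an` rational under BSD, or directly from file 3's datum)
  have hS : SchneiderConjecture Dh :=
    (hX.schneider_and_padicVal_identity_rankOne_of_katoHalf_of_cert hK hmodD hGZK hp5 he hsurj hr hcert
      hB).1
  intro V iV iVm N _ f hp4' hVW hV hf ϖ hϖ
  obtain ⟨C, hC⟩ := hVW
  have hps : ((-1 : ℚ) ^ (p / 2) * (p : ℚ)) = (p : ℚ) := by rw [heven.neg_one_pow, one_mul]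
  have hC' : C • V.quadraticTwist ((-1 : ℚ) ^ (p / 2) * p) = W := by rw [hps]; exact hC
  have hϖ' : (if Even (p / 2) then (ϖ : ℝ) * V.realPeriodRat = plusPeriod f
      else (ϖ : ℝ) * V.imaginaryPeriodRat = minusPeriod f) := by rw [if_pos heven]; exact hϖ
  have hord : IsOrdinaryAt V p :=
    isOrdinaryAt_of_goodOrd_or_mult_of_model_twist W V (pStar_ne_zero p) ⟨C, hC'⟩
      (padicValRat_j_nonneg_of_typeGOrd W p hX.typeGOrd) (Or.inl hV)
  obtain ⟨-, h1⟩ := hcert V C hC' hord f hf ϖ hϖ'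
  rw [if_pos heven, PowerSeries.coeff_C_mul] at h1
  -- `#Ш_an = q'·…` : get `q` from BSD(E,p)'s rationality via `shaAn`
  obtain ⟨s, hs, -⟩ := missingPPartAt_of_bsdp W p hbsd
  -- define q := s·∏c/#T²; then L' = q Ω Reg_∞
  have hΩpos : 0 < W.realPeriodRat := W.realPeriodRat_pos_holds
  have hT0 : W.torsionOrder ≠ 0 := (W.torsionOrder_pos_holds).ne'
  have hPpos : 0 < W.tamagawaProduct := W.tamagawaProduct_pos_holds
  have hRpos : 0 < W.regulator := regulator_pos_holds W
  set q : ℚ := s * (W.tamagawaProduct : ℚ) / (W.torsionOrder : ℚ) ^ 2 with hq_def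
  have hLq : W.leadingLCoeff = (q : ℂ) * (W.realPeriodRat : ℂ) * (W.regulator : ℂ) := by
    have hΩC : (W.realPeriodRat : ℂ) ≠ 0 := by exact_mod_cast hΩpos.ne'
    have hTC : (W.torsionOrder : ℂ) ≠ 0 := by exact_mod_cast hT0
    have hPC : (W.tamagawaProduct : ℂ) ≠ 0 := by exact_mod_cast hPpos.ne'
    have hRC : (W.regulator : ℂ) ≠ 0 := by exact_mod_cast hRpos.ne'
    have h := hs
    rw [shaAn_def, div_eq_iff (mul_ne_zero (mul_ne_zero hΩC hPC) hRC)] at h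
    rw [hq_def]
    push_cast
    field_simp
    linear_combination h
  -- file 3: `ord q + ord Reg_p = 1`
  have hvq : padicValRat p q + (padicRegulator Dh).valuation = 1 :=
    (hX.bsdp_iff_padicVal_rankOne_of_katoHalf_of_cert hK hmodD hGZK hmod hp5 he hsurj hr hna hcert hB
      hLq).mp hbsd
  -- valuations of both sides
  have hq0 : q ≠ 0 := by
    rintro h0
    rw [h0, Rat.cast_zero, zero_mul, zero_mul] at hLq
    exact W.leadingLCoeff_ne_zero_holds (hmod W) hLq
  have hqQ : ((q : ℚ) : ℚ_[p]) ≠ 0 := by exact_mod_cast hq0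
  have hReg : padicRegulator Dh ≠ 0 := hS
  obtain ⟨w, hw⟩ := exists_unit_padicLog_cyclotomicGenerator (p := p) (by omega)
  have hpQ : (p : ℚ_[p]) ≠ 0 := by exact_mod_cast hpP.ne_zero
  have hlog0 : padicLog p (cyclotomicGenerator p : ℚ_[p]) ≠ 0 := by
    rw [hw]; exact mul_ne_zero hpQ (coe_units_ne_zero p w)
  have hlogv : (padicLog p (cyclotomicGenerator p : ℚ_[p])).valuation = 1 := by
    rw [hw, Padic.valuation_mul hpQ (coe_units_ne_zero p w), Padic.valuation_p,
      valuation_coe_units_eq_zero, add_zero]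
  have hx0 : (ϖ : ℚ_[p]) * PowerSeries.coeff 1
      (padicLFunctionBranch f ((unitRoot V p : ℤ_[p]) : ℚ_[p]) (p / 2)) ≠ 0 := by
    intro h0; rw [h0, norm_zero] at h1; exact zero_ne_one h1
  have hxv : ((ϖ : ℚ_[p]) * PowerSeries.coeff 1
      (padicLFunctionBranch f ((unitRoot V p : ℤ_[p]) : ℚ_[p]) (p / 2))).valuation = 0 := by
    have := Padic.norm_eq_zpow_neg_valuation hx0
    rw [h1] at this
    have h' : ((p : ℝ) ^ (-((ϖ : ℚ_[p]) * PowerSeries.coeff 1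
        (padicLFunctionBranch f ((unitRoot V p : ℤ_[p]) : ℚ_[p]) (p / 2))).valuation)) = 1 :=
      this.symm
    have hp1 : (1 : ℝ) < p := by exact_mod_cast hpP.one_lt
    have := zpow_right_injective₀ (by positivity) hp1.ne' (h'.trans (zpow_zero _).symm)
    linarith
  -- the quotient `x := (ϖ[T¹]B·log γ)/(q·Reg_p)` is a unit
  set num : ℚ_[p] := (ϖ : ℚ_[p]) * PowerSeries.coeff 1
      (padicLFunctionBranch f ((unitRoot V p : ℤ_[p]) : ℚ_[p]) (p / 2)) *
      padicLog p (cyclotomicGenerator p) with hnum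
  set den : ℚ_[p] := ((q : ℚ) : ℚ_[p]) * padicRegulator Dh with hden
  have hnum0 : num ≠ 0 := mul_ne_zero hx0 hlog0
  have hden0 : den ≠ 0 := mul_ne_zero hqQ hReg
  have hnumv : num.valuation = 1 := by
    rw [hnum, Padic.valuation_mul hx0 hlog0, hxv, hlogv, zero_add]
  have hdenv : den.valuation = 1 := by
    rw [hden, Padic.valuation_mul hqQ hReg, Padic.valuation_ratCast]
    exact hvq
  have hxval : (num / den).valuation = 0 := by
    have hprod : num / den * den = num := div_mul_cancel₀ num hden0
    have hv := congrArg Padic.valuation hprod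
    rw [Padic.valuation_mul (div_ne_zero hnum0 hden0) hden0, hnumv, hdenv] at hv
    linarith
  obtain ⟨u, hu⟩ := exists_units_coe_eq_of_valuation_eq_zero (div_ne_zero hnum0 hden0) hxval
  refine ⟨u, q, hLq, ?_⟩
  have hcancel : num / den * den = num := div_mul_cancel₀ num hden0
  rw [hr1, pow_one, hu]
  simp only [hnum, hden] at hcancel ⊢
  linear_combination -hcancel

end Summit.BirchSwinnertonDyer.Rank1Residual.Additive

end
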